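import Mathlib
import Summits.ValiantsHypothesis.ValiantsHypothesis.Theses.ValuativeGCT
import Literature.Computability.AlgebraicComplexity.OrbitClosureWeights
import Summits.ValiantsHypothesis.ValiantsHypothesis.Theorems.ValuativeGCTValuativeFlipFourRowBridgeBlock
import Summits.ValiantsHypothesis.ValiantsHypothesis.Theorems.ValuativeGCTValuativeFlipFourRowBridgePer
import Summits.ValiantsHypothesis.ValiantsHypothesis.Theorems.ValuativeGCTValuativeFlipFourRowHwspSupport
import Summits.ValiantsHypothesis.ValiantsHypothesis.Theorems.ValuativeGCTValuativeFlipBottomBridge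
import Summits.ValiantsHypothesis.ValiantsHypothesis.Theorems.ValuativeGCTValuativeFlipMultiplicityCount

/-!
# The four-row bridge (`GL₄`-equivariant dimension gap ⇒ flipping weight with `≤ 4` rows)

Stub `stub_fourRowBridge` of line `four-row-count` for crux `ValuativeGCT.HeadFlip`
(stmt-ValiantsHypothesis-15535; verbatim the stub of the same name of the parent crux
`ValuativeGCT.ValuativeFlip`, stmt-ValiantsHypothesis-12624).

`W = ℂ^{m×m}`, `R = ℂ[End W] = MvPolynomial (MatIdx m × MatIdx m) ℂ` (variables `X (j, i)`, row slot
`j`, matrix position `i`); `K = {p}` the kept row slots (an upper set; for the stub, the last four slots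
`m² ≤ idx j + 4`).  The block (Levi) embedding `GL(K) → GL(W)`, `g ↦ blk(g) = reindex _ _ (fromBlocks g 0 0 1)`
(written out, as in `…FourRowBridgeBlock`), acts by left translation `G ↦ G(blk(g⁻¹) ·)` on the det-side
four-row module `S_D = Hom_{mδ} ⊓ SAND ⊓ ROWS_K` (`hfb_det_stable`) and on the per-side four-row image
`S_P = Φ(Hom_δ ⊓ SUPP_K)`, `Φ = genericOrbitMap (X₀₀^{m-n} per_n) m` (`hfb_per_stable`), as finite-dimensional
rational representations (`hfb_exists_rep`).  A gap `dim S_D < dim S_P` gives, by the counting lemma B4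
(`stub_multiplicityCount`), a `GL(K)`-weight `χ₄` with `hwMult_{S_D}(χ₄) < hwMult_{S_P}(χ₄)`; block-Borel and
full-Borel semi-invariance agree on functions of the `K`-rows (`fourRow_borel_of_blockBorel`,
`frb_blockBorel_of_borel`), so a nonzero per-side highest-weight vector pins the extension by zero
`χ̃₄ = λ*`, `λ ⊢ mδ` (`frb_exists_partition_of_hwv`), `ℓ(λ) ≤ |K|` (`frb_card_parts_le_of_toMatIdx_eq_zero`),
and `dim (S_D ⊓ HWSP(λ*)) ≤ hwMult_{S_D} < hwMult_{S_P} ≤ dim (HWSP(λ*) ⊓ S_P) ≤ mult_{λ*} ℂ[Δ_m(X₀₀^{m-n} per_n)]`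
(`fourRow_hwsp_inf_map_genericOrbitMap_le_orbitMultiplicity`); for `ℓ(λ) ≤ 4` the det-side multiplicity
space `Hom ⊓ SAND ⊓ HWSP(λ*)` already lies in `S_D` (`fourRow_detMult_le_fourRow`).
BLMW 2011 §5.2; Goodman–Wallach §1.5, §3.2, §4.1; Mulmuley–Sohoni 2001 §4. [folklore]
-/

-- `Summit.ValiantsHypothesis.ValiantsHypothesis.…` is the tree's mandated single-conjunct layout (Sub = Summit).
set_option linter.dupNamespace false

namespace Summit.ValiantsHypothesis.ValiantsHypothesis.Theorems.HeadFlip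

open MvPolynomial
open scoped BigOperators Matrix
open Literature.NumberTheory.DiophantineGeometry
open Literature.Computability.AlgebraicComplexity
open Summit.ValiantsHypothesis.ValiantsHypothesis.Theorems.ValuativeFlip
open Summit.ValiantsHypothesis.ValiantsHypothesis.Theorems.CutBitesAdjugate

noncomputable section

section Block

variable {m : ℕ} (p : MatIdx m → Prop) [DecidablePred p]

/-- **Det side is `GL(K)`-stable.** Left translation through the block embedding preserves the
four-row det-side module `Hom_D ⊓ SAND ⊓ ROWS_K`: it preserves degrees (`hwx_leftAct_isHomogeneous`),
commutes with the row-wise sandwich substitutions (`sb_leftAct_sandwich_comm`) and preserves the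
functions of the `K`-rows (`frb_leftAct_blk_mem_supported`). [folklore] -/
theorem hfb_det_stable (D : ℕ) (g : Matrix {a // p a} {a // p a} ℂ)
    (F : MvPolynomial (MatIdx m × MatIdx m) ℂ)
    (hF : F ∈ MvPolynomial.homogeneousSubmodule (MatIdx m × MatIdx m) ℂ D ⊓
        (⨅ (P : Matrix (Fin m) (Fin m) ℂ) (Q : Matrix (Fin m) (Fin m) ℂ) (_ : P.det = 1) (_ : Q.det = 1),
          LinearMap.ker ((MvPolynomial.aeval fun q : MatIdx m × MatIdx m =>
              ∑ l : MatIdx m, (P (ofLex q.2).1 (ofLex l).1 * Q (ofLex l).2 (ofLex q.2).2) •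
                (MvPolynomial.X (q.1, l) : MvPolynomial (MatIdx m × MatIdx m) ℂ)).toLinearMap -
            (LinearMap.id : MvPolynomial (MatIdx m × MatIdx m) ℂ →ₗ[ℂ] MvPolynomial (MatIdx m × MatIdx m) ℂ))) ⊓
        Subalgebra.toSubmodule (MvPolynomial.supported ℂ {q : MatIdx m × MatIdx m | p q.1})) :
    MvPolynomial.aeval (R := ℂ) (fun q : MatIdx m × MatIdx m =>
        ∑ l : MatIdx m, Matrix.reindex (Equiv.sumCompl p) (Equiv.sumCompl p)
          (Matrix.fromBlocks g 0 0 (1 : Matrix {a // ¬ p a} {a // ¬ p a} ℂ)) q.1 l •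
            (X (l, q.2) : MvPolynomial (MatIdx m × MatIdx m) ℂ)) F ∈
      MvPolynomial.homogeneousSubmodule (MatIdx m × MatIdx m) ℂ D ⊓
        (⨅ (P : Matrix (Fin m) (Fin m) ℂ) (Q : Matrix (Fin m) (Fin m) ℂ) (_ : P.det = 1) (_ : Q.det = 1),
          LinearMap.ker ((MvPolynomial.aeval fun q : MatIdx m × MatIdx m =>
              ∑ l : MatIdx m, (P (ofLex q.2).1 (ofLex l).1 * Q (ofLex l).2 (ofLex q.2).2) •
                (MvPolynomial.X (q.1, l) : MvPolynomial (MatIdx m × MatIdx m) ℂ)).toLinearMap -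
            (LinearMap.id : MvPolynomial (MatIdx m × MatIdx m) ℂ →ₗ[ℂ] MvPolynomial (MatIdx m × MatIdx m) ℂ))) ⊓
        Subalgebra.toSubmodule (MvPolynomial.supported ℂ {q : MatIdx m × MatIdx m | p q.1}) := by
  obtain ⟨hF', hFr⟩ := Submodule.mem_inf.mp hF
  obtain ⟨hFh, hFs⟩ := Submodule.mem_inf.mp hF'
  refine Submodule.mem_inf.mpr ⟨Submodule.mem_inf.mpr ⟨?_, ?_⟩, frb_leftAct_blk_mem_supported p g hFr⟩
  · exact (mem_homogeneousSubmodule _ _).mpr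
      (hwx_leftAct_isHomogeneous _ ((mem_homogeneousSubmodule _ _).mp hFh))
  · simp only [Submodule.mem_iInf, LinearMap.mem_ker, LinearMap.sub_apply, LinearMap.id_coe, id_eq,
      AlgHom.toLinearMap_apply, sub_eq_zero] at hFs ⊢
    intro P Q hP hQ
    rw [← sb_leftAct_sandwich_comm, hFs P Q hP hQ]

/-- **Per side is `GL(K)`-stable.** Left translation by `blk(g⁻¹)` maps `Φ F` to `Φ (g' · F)` for the
block-embedded `g' = blk(g) ∈ GL(W)` (`frb_leftAct_inv_genericOrbitMap`; the block embedding is a monoid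
homomorphism, `frb_blk_one`, `frb_blk_mul`), and `g' ·` preserves the forms of degree `δ` in the kept
coefficients (`isHomogeneous_coordSubst`, `frb_coordSubst_mem_supported`: the non-kept columns of
`blk(g⁻¹)` are unit vectors). Mulmuley–Sohoni 2001 §4. [folklore] -/
theorem hfb_per_stable (f : MvPolynomial (MatIdx m) ℂ) (δ : ℕ) (g : GL {a // p a} ℂ)
    (N : Submodule ℂ (MvPolynomial (DegIdx (MatIdx m) m) ℂ))
    (hN : N = MvPolynomial.homogeneousSubmodule (DegIdx (MatIdx m) m) ℂ δ ⊓
      Subalgebra.toSubmodule (MvPolynomial.supported ℂ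
        {d : DegIdx (MatIdx m) m | ∀ i : MatIdx m, ¬ p i → d.1 i = 0}))
    (G : MvPolynomial (MatIdx m × MatIdx m) ℂ) (hG : G ∈ N.map (genericOrbitMap f m).toLinearMap) :
    MvPolynomial.aeval (R := ℂ) (fun q : MatIdx m × MatIdx m =>
        ∑ l : MatIdx m, Matrix.reindex (Equiv.sumCompl p) (Equiv.sumCompl p)
          (Matrix.fromBlocks ((g⁻¹ : GL {a // p a} ℂ) : Matrix {a // p a} {a // p a} ℂ) 0 0
            (1 : Matrix {a // ¬ p a} {a // ¬ p a} ℂ)) q.1 l •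
            (X (l, q.2) : MvPolynomial (MatIdx m × MatIdx m) ℂ)) G ∈
      N.map (genericOrbitMap f m).toLinearMap := by
  subst hN
  obtain ⟨F, hF, rfl⟩ := Submodule.mem_map.mp hG
  obtain ⟨hFh, hFk⟩ := Submodule.mem_inf.mp hF
  -- the block embedding as a monoid homomorphism, and `g' = blk(g) ∈ GL(W)` with `g'⁻¹ = blk(g⁻¹)`
  let φ : Matrix {a // p a} {a // p a} ℂ →* Matrix (MatIdx m) (MatIdx m) ℂ :=
    { toFun := fun g => Matrix.reindex (Equiv.sumCompl p) (Equiv.sumCompl p)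
        (Matrix.fromBlocks g 0 0 (1 : Matrix {a // ¬ p a} {a // ¬ p a} ℂ))
      map_one' := frb_blk_one p
      map_mul' := frb_blk_mul p }
  have hg' : (((Units.map φ g)⁻¹ : GL (MatIdx m) ℂ) : Matrix (MatIdx m) (MatIdx m) ℂ) =
      Matrix.reindex (Equiv.sumCompl p) (Equiv.sumCompl p)
        (Matrix.fromBlocks ((g⁻¹ : GL {a // p a} ℂ) : Matrix {a // p a} {a // p a} ℂ) 0 0
          (1 : Matrix {a // ¬ p a} {a // ¬ p a} ℂ)) := rfl
  rw [AlgHom.toLinearMap_apply, ← hg', frb_leftAct_inv_genericOrbitMap]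
  refine Submodule.mem_map.mpr ⟨coordSubst m (Units.map φ g) F, Submodule.mem_inf.mpr ⟨?_, ?_⟩, rfl⟩
  · exact (mem_homogeneousSubmodule _ _).mpr
      (isHomogeneous_coordSubst _ ((mem_homogeneousSubmodule _ _).mp hFh))
  · exact frb_coordSubst_mem_supported p (Units.map φ g) (fun i hi a => by
      rw [hg']
      exact frb_blk_apply_of_neg_right p _ a hi) hFk

/-- **The left translation of `GL(K)` through the block embedding on a stable subspace is a rational
representation.**  For a subspace `S ⊆ ℂ[End W]` stable under `G ↦ G(blk(g⁻¹) ·)`, `g ∈ GL(K)`, this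
action is a representation of `GL(K)` (the block embedding is multiplicative, left translations
compose contravariantly, `hwx_leftAct_leftAct`) whose matrix coefficients are polynomials in the
entries of `g⁻¹` (`hwx_exists_eval_eq_apply_leftAct` composed with the entries of `blk`), hence
rational (`isRationalRep_of_forall_exists_eval_inv`).  Built inside the proof (no definitions).
Goodman–Wallach §1.5. [folklore] -/
theorem hfb_exists_rep (S : Submodule ℂ (MvPolynomial (MatIdx m × MatIdx m) ℂ))
    (hS : ∀ g : GL {a // p a} ℂ, ∀ G ∈ S,
      MvPolynomial.aeval (R := ℂ) (fun q : MatIdx m × MatIdx m =>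
        ∑ l : MatIdx m, Matrix.reindex (Equiv.sumCompl p) (Equiv.sumCompl p)
          (Matrix.fromBlocks ((g⁻¹ : GL {a // p a} ℂ) : Matrix {a // p a} {a // p a} ℂ) 0 0
            (1 : Matrix {a // ¬ p a} {a // ¬ p a} ℂ)) q.1 l •
            (X (l, q.2) : MvPolynomial (MatIdx m × MatIdx m) ℂ)) G ∈ S) :
    ∃ ρ : Representation ℂ (GL {a // p a} ℂ) ↥S, IsRationalRep ρ ∧
      ∀ (g : GL {a // p a} ℂ) (v : ↥S), ((ρ g v : ↥S) : MvPolynomial (MatIdx m × MatIdx m) ℂ) =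
        MvPolynomial.aeval (R := ℂ) (fun q : MatIdx m × MatIdx m =>
          ∑ l : MatIdx m, Matrix.reindex (Equiv.sumCompl p) (Equiv.sumCompl p)
            (Matrix.fromBlocks ((g⁻¹ : GL {a // p a} ℂ) : Matrix {a // p a} {a // p a} ℂ) 0 0
              (1 : Matrix {a // ¬ p a} {a // ¬ p a} ℂ)) q.1 l •
              (X (l, q.2) : MvPolynomial (MatIdx m × MatIdx m) ℂ)) (v : MvPolynomial (MatIdx m × MatIdx m) ℂ) := by
  let ρ : Representation ℂ (GL {a // p a} ℂ) ↥S :=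
    { toFun := fun g => (MvPolynomial.aeval (R := ℂ) (fun q : MatIdx m × MatIdx m =>
          ∑ l : MatIdx m, Matrix.reindex (Equiv.sumCompl p) (Equiv.sumCompl p)
            (Matrix.fromBlocks ((g⁻¹ : GL {a // p a} ℂ) : Matrix {a // p a} {a // p a} ℂ) 0 0
              (1 : Matrix {a // ¬ p a} {a // ¬ p a} ℂ)) q.1 l •
              (X (l, q.2) : MvPolynomial (MatIdx m × MatIdx m) ℂ))).toLinearMap.restrict (hS g)
      map_one' := LinearMap.ext fun v => Subtype.ext <| by
        change MvPolynomial.aeval (R := ℂ) (fun q : MatIdx m × MatIdx m =>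
          ∑ l : MatIdx m, Matrix.reindex (Equiv.sumCompl p) (Equiv.sumCompl p)
            (Matrix.fromBlocks (((1 : GL {a // p a} ℂ)⁻¹ : GL {a // p a} ℂ) : Matrix {a // p a} {a // p a} ℂ) 0 0
              (1 : Matrix {a // ¬ p a} {a // ¬ p a} ℂ)) q.1 l •
              (X (l, q.2) : MvPolynomial (MatIdx m × MatIdx m) ℂ)) (v : MvPolynomial (MatIdx m × MatIdx m) ℂ) = _
        rw [inv_one, Units.val_one, frb_blk_one]
        exact hwx_leftAct_one _
      map_mul' := fun g h => LinearMap.ext fun v => Subtype.ext <| by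
        change MvPolynomial.aeval (R := ℂ) (fun q : MatIdx m × MatIdx m =>
          ∑ l : MatIdx m, Matrix.reindex (Equiv.sumCompl p) (Equiv.sumCompl p)
            (Matrix.fromBlocks (((g * h)⁻¹ : GL {a // p a} ℂ) : Matrix {a // p a} {a // p a} ℂ) 0 0
              (1 : Matrix {a // ¬ p a} {a // ¬ p a} ℂ)) q.1 l •
              (X (l, q.2) : MvPolynomial (MatIdx m × MatIdx m) ℂ)) (v : MvPolynomial (MatIdx m × MatIdx m) ℂ) = _
        rw [mul_inv_rev, Units.val_mul, frb_blk_mul, ← hwx_leftAct_leftAct]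
        rfl }
  have hρv : ∀ (g : GL {a // p a} ℂ) (v : ↥S), ((ρ g v : ↥S) : MvPolynomial (MatIdx m × MatIdx m) ℂ) =
      MvPolynomial.aeval (R := ℂ) (fun q : MatIdx m × MatIdx m =>
        ∑ l : MatIdx m, Matrix.reindex (Equiv.sumCompl p) (Equiv.sumCompl p)
          (Matrix.fromBlocks ((g⁻¹ : GL {a // p a} ℂ) : Matrix {a // p a} {a // p a} ℂ) 0 0
            (1 : Matrix {a // ¬ p a} {a // ¬ p a} ℂ)) q.1 l •
            (X (l, q.2) : MvPolynomial (MatIdx m × MatIdx m) ℂ)) (v : MvPolynomial (MatIdx m × MatIdx m) ℂ) :=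
    fun _ _ => rfl
  refine ⟨ρ, isRationalRep_of_forall_exists_eval_inv fun v φ => ?_, hρv⟩
  obtain ⟨ψ, hψ⟩ := LinearMap.exists_extend φ
  obtain ⟨Q, hQ⟩ := hwx_exists_eval_eq_apply_leftAct (v : MvPolynomial (MatIdx m × MatIdx m) ℂ) ψ
  -- the entries of `blk(g⁻¹)` as polynomials in the entries of `g⁻¹`
  let θ : MatIdx m × MatIdx m → MvPolynomial ({a // p a} × {a // p a}) ℂ := fun ij =>
    if hb : p ij.2 then
      (if ha : p ij.1 then (X (⟨ij.1, ha⟩, ⟨ij.2, hb⟩) : MvPolynomial ({a // p a} × {a // p a}) ℂ) else 0)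
    else C (if ij.1 = ij.2 then (1 : ℂ) else 0)
  refine ⟨bind₁ θ Q, fun g => ?_⟩
  have hθ : (fun ij : MatIdx m × MatIdx m => MvPolynomial.eval
      (fun ij : {a // p a} × {a // p a} => ((g⁻¹ : GL {a // p a} ℂ) : Matrix {a // p a} {a // p a} ℂ) ij.1 ij.2)
        (θ ij)) =
      fun ij : MatIdx m × MatIdx m => Matrix.reindex (Equiv.sumCompl p) (Equiv.sumCompl p)
        (Matrix.fromBlocks ((g⁻¹ : GL {a // p a} ℂ) : Matrix {a // p a} {a // p a} ℂ) 0 0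
          (1 : Matrix {a // ¬ p a} {a // ¬ p a} ℂ)) ij.1 ij.2 := by
    funext ij
    by_cases hb : p ij.2
    · by_cases ha : p ij.1
      · simp only [θ, dif_pos hb, dif_pos ha, eval_X, frb_blk_apply_pos_pos p _ ha hb]
      · simp only [θ, dif_pos hb, dif_neg ha, map_zero, frb_blk_apply_neg_pos p _ ha hb]
    · simp only [θ, dif_neg hb, eval_C, frb_blk_apply_of_neg_right p _ _ hb]
  have hev : MvPolynomial.eval
      (fun ij : {a // p a} × {a // p a} => ((g⁻¹ : GL {a // p a} ℂ) : Matrix {a // p a} {a // p a} ℂ) ij.1 ij.2)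
        (bind₁ θ Q) =
      MvPolynomial.eval (fun ij : MatIdx m × MatIdx m => MvPolynomial.eval
        (fun ij : {a // p a} × {a // p a} => ((g⁻¹ : GL {a // p a} ℂ) : Matrix {a // p a} {a // p a} ℂ) ij.1 ij.2)
          (θ ij)) Q :=
    eval₂Hom_bind₁ _ _ _ _
  -- assembled inside the file's own instance context, then matched up to unfolding of instances
  have hmain : φ (ρ g v) = MvPolynomial.eval
      (fun ij : {a // p a} × {a // p a} => ((g⁻¹ : GL {a // p a} ℂ) : Matrix {a // p a} {a // p a} ℂ) ij.1 ij.2)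
        (bind₁ θ Q) := by
    calc φ (ρ g v) = ψ ((ρ g v : ↥S) : MvPolynomial (MatIdx m × MatIdx m) ℂ) := by rw [← hψ]; rfl
      _ = MvPolynomial.eval (fun ij : MatIdx m × MatIdx m => Matrix.reindex (Equiv.sumCompl p) (Equiv.sumCompl p)
            (Matrix.fromBlocks ((g⁻¹ : GL {a // p a} ℂ) : Matrix {a // p a} {a // p a} ℂ) 0 0
              (1 : Matrix {a // ¬ p a} {a // ¬ p a} ℂ)) ij.1 ij.2) Q := by rw [hρv]; exact hQ _
      _ = _ := by rw [hev, hθ]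
  exact hmain

end Block

/-! ### The bridge -/

/-- **The `GL(K)`-equivariant bridge.**  `K = {p}` an upper set of row slots, `S_D ⊆ Hom_D` a subspace of
`ℂ[End W]` stable under the left translations `G ↦ G(blk(g⁻¹) ·)`, `g ∈ GL(K)`, and
`S_P = Φ(Hom_δ ⊓ SUPP_K)` the per-side four-row image (`Φ = genericOrbitMap (X₀₀^{m-n} per_n) m`).  If
`dim S_D < dim S_P` then for some partition `λ ⊢ mδ` (`≤ m²` parts) whose dual weight `λ*` vanishes off
`K`, `dim (S_D ⊓ HWSP(λ*)) < mult_{λ*} ℂ[Δ_m(X₀₀^{m-n} per_n)]`: both sides are finite-dimensional rational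
`GL(K)`-modules (`hfb_exists_rep`), the counting lemma (`stub_multiplicityCount`) gives a `GL(K)`-weight
`χ₄` with `hwMult_{S_D}(χ₄) < hwMult_{S_P}(χ₄)`, a nonzero per-side highest-weight vector is a full-Borel
semi-invariant of weight `χ̃₄` (`fourRow_borel_of_blockBorel`), which pins `χ̃₄ = λ*`
(`frb_exists_partition_of_hwv`), and `dim (S_D ⊓ HWSP(χ̃₄)) ≤ hwMult_{S_D}(χ₄)` (`frb_blockBorel_of_borel`),
`hwMult_{S_P}(χ₄) ≤ dim (HWSP(χ̃₄) ⊓ S_P) ≤ mult` (`fourRow_hwsp_inf_map_genericOrbitMap_le_orbitMultiplicity`).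
BLMW 2011 §5.2; Goodman–Wallach §3.2, §4.1. [folklore] -/
theorem hfb_bridge {m : ℕ} [NeZero m] (p : MatIdx m → Prop) [DecidablePred p]
    (hp : ∀ a b : MatIdx m, a ≤ b → p a → p b) (n δ D : ℕ)
    (SD : Submodule ℂ (MvPolynomial (MatIdx m × MatIdx m) ℂ))
    (hSDle : SD ≤ MvPolynomial.homogeneousSubmodule (MatIdx m × MatIdx m) ℂ D)
    (hSD : ∀ g : GL {a // p a} ℂ, ∀ G ∈ SD,
      MvPolynomial.aeval (R := ℂ) (fun q : MatIdx m × MatIdx m =>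
        ∑ l : MatIdx m, Matrix.reindex (Equiv.sumCompl p) (Equiv.sumCompl p)
          (Matrix.fromBlocks ((g⁻¹ : GL {a // p a} ℂ) : Matrix {a // p a} {a // p a} ℂ) 0 0
            (1 : Matrix {a // ¬ p a} {a // ¬ p a} ℂ)) q.1 l •
            (X (l, q.2) : MvPolynomial (MatIdx m × MatIdx m) ℂ)) G ∈ SD)
    (hgap : Module.finrank ℂ ↥SD <
      Module.finrank ℂ ↥((MvPolynomial.homogeneousSubmodule (DegIdx (MatIdx m) m) ℂ δ ⊓
        Subalgebra.toSubmodule (MvPolynomial.supported ℂ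
          {d : DegIdx (MatIdx m) m | ∀ i : MatIdx m, ¬ p i → d.1 i = 0})).map
        (genericOrbitMap (paddedPerFormLex ℂ n m) m).toLinearMap)) :
    ∃ lam : Nat.Partition (m * δ), lam.parts.card ≤ m * m ∧
      (∀ a : MatIdx m, ¬ p a → ((Weight.dualOfPartition (m * m) lam).toMatIdx : Weight (MatIdx m)) a = 0) ∧
      Module.finrank ℂ ↥(SD ⊓
          (⨅ (g : Matrix.GeneralLinearGroup (MatIdx m) ℂ) (_ : IsUpperTriangular g),
              LinearMap.ker ((MvPolynomial.aeval fun q : MatIdx m × MatIdx m =>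
                  ∑ l : MatIdx m, ((g⁻¹ : Matrix.GeneralLinearGroup (MatIdx m) ℂ) :
                    Matrix (MatIdx m) (MatIdx m) ℂ) q.1 l •
                      (MvPolynomial.X (l, q.2) : MvPolynomial (MatIdx m × MatIdx m) ℂ)).toLinearMap -
                weightChar ((Weight.dualOfPartition (m * m) lam).toMatIdx : Weight (MatIdx m)) g •
                  (LinearMap.id : MvPolynomial (MatIdx m × MatIdx m) ℂ →ₗ[ℂ] MvPolynomial (MatIdx m × MatIdx m) ℂ)))) <
        orbitMultiplicity ℂ (paddedPerFormLex ℂ n m) m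
          ((Weight.dualOfPartition (m * m) lam).toMatIdx : Weight (MatIdx m)) := by
  -- finiteness
  haveI : Module.Finite ℂ ↥(MvPolynomial.homogeneousSubmodule (MatIdx m × MatIdx m) ℂ D) :=
    Module.Finite.iff_fg.mpr (MvPolynomial.homogeneousSubmodule_fg _ _ _)
  haveI : Module.Finite ℂ ↥SD := Submodule.finiteDimensional_of_le hSDle
  set NP : Submodule ℂ (MvPolynomial (DegIdx (MatIdx m) m) ℂ) :=
    MvPolynomial.homogeneousSubmodule (DegIdx (MatIdx m) m) ℂ δ ⊓
      Subalgebra.toSubmodule (MvPolynomial.supported ℂ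
        {d : DegIdx (MatIdx m) m | ∀ i : MatIdx m, ¬ p i → d.1 i = 0}) with hNP
  haveI : Module.Finite ℂ ↥(MvPolynomial.homogeneousSubmodule (DegIdx (MatIdx m) m) ℂ δ) :=
    Module.Finite.iff_fg.mpr (MvPolynomial.homogeneousSubmodule_fg _ _ _)
  haveI : Module.Finite ℂ ↥NP := Submodule.finiteDimensional_of_le inf_le_left
  haveI : Module.Finite ℂ ↥(NP.map (genericOrbitMap (paddedPerFormLex ℂ n m) m).toLinearMap) :=
    inferInstance
  -- the two rational representations of `GL(K)` and the counting lemma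
  obtain ⟨ρD, hρDrat, hρD⟩ := hfb_exists_rep p SD hSD
  obtain ⟨ρP, hρPrat, hρP⟩ := hfb_exists_rep p
    (NP.map (genericOrbitMap (paddedPerFormLex ℂ n m) m).toLinearMap)
    (fun g G hG => hfb_per_stable p (paddedPerFormLex ℂ n m) δ g NP hNP G hG)
  obtain ⟨χ₄, hχ⟩ := stub_multiplicityCount {a // p a} _ _ ρP ρD hρPrat hρDrat hgap
  -- a nonzero per-side highest-weight vector `Φ F` pins the weight
  have hne : hwMultiplicity ρP χ₄ ≠ 0 := (lt_of_le_of_lt (Nat.zero_le _) hχ).ne'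
  obtain ⟨v, hv0, hv⟩ := (hasHighestWeight_iff_exists ρP χ₄).mp
    ((hasHighestWeight_iff_hwMultiplicity_ne_zero ρP χ₄).mpr hne)
  obtain ⟨F, hFN, hFv⟩ := Submodule.mem_map.mp v.2
  rw [AlgHom.toLinearMap_apply] at hFv
  have hfull := fourRow_borel_of_blockBorel p hp χ₄
    (frb_genericOrbitMap_mem_supported p (paddedPerFormLex ℂ n m) (Submodule.mem_inf.mp hFN).2)
    fun b hb => by
      rw [hFv]
      exact (hρP b v).symm.trans (congrArg Subtype.val ((mem_highestWeightSpace_iff _ _ _).mp hv b hb))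
  have h0 : genericOrbitMap (paddedPerFormLex ℂ n m) m F ≠ 0 := fun h =>
    hv0 (Subtype.ext (hFv.symm.trans h))
  obtain ⟨lam, hlamN, hχeq⟩ := frb_exists_partition_of_hwv n δ
    (fun a : MatIdx m => if h : p a then χ₄ ⟨a, h⟩ else 0) (Submodule.mem_inf.mp hFN).1 h0 hfull
  refine ⟨lam, hlamN, fun a ha => ?_, ?_⟩
  · rw [← hχeq]
    exact dif_neg ha
  rw [← hχeq]
  set H : Submodule ℂ (MvPolynomial (MatIdx m × MatIdx m) ℂ) :=
    (⨅ (g : Matrix.GeneralLinearGroup (MatIdx m) ℂ) (_ : IsUpperTriangular g),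
        LinearMap.ker ((MvPolynomial.aeval fun q : MatIdx m × MatIdx m =>
            ∑ l : MatIdx m, ((g⁻¹ : Matrix.GeneralLinearGroup (MatIdx m) ℂ) :
              Matrix (MatIdx m) (MatIdx m) ℂ) q.1 l •
                (MvPolynomial.X (l, q.2) : MvPolynomial (MatIdx m × MatIdx m) ℂ)).toLinearMap -
          weightChar (fun a : MatIdx m => if h : p a then χ₄ ⟨a, h⟩ else 0) g •
            (LinearMap.id : MvPolynomial (MatIdx m × MatIdx m) ℂ →ₗ[ℂ] MvPolynomial (MatIdx m × MatIdx m) ℂ)))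
    with hH
  -- det side: `S_D ⊓ HWSP(χ̃₄)` consists of block highest-weight vectors of `ρD`
  have hleD : SD ⊓ H ≤ (highestWeightSpace ρD χ₄).map SD.subtype := by
    intro G hG
    obtain ⟨hGS, hGH⟩ := Submodule.mem_inf.mp hG
    refine Submodule.mem_map.mpr
      ⟨⟨G, hGS⟩, (mem_highestWeightSpace_iff _ _ _).mpr fun b hb => Subtype.ext ?_, rfl⟩
    rw [hH] at hGH
    refine (hρD b ⟨G, hGS⟩).trans (frb_blockBorel_of_borel p χ₄ (fun g hg => ?_) b hb)
    have h := (Submodule.mem_iInf _).mp ((Submodule.mem_iInf _).mp hGH g) hg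
    rw [LinearMap.mem_ker, LinearMap.sub_apply, sub_eq_zero] at h
    exact h
  -- per side: block highest-weight vectors of `ρP` lie in `HWSP(χ̃₄) ⊓ S_P` (functions of the `K`-rows)
  have hleP : (highestWeightSpace ρP χ₄).map
        (NP.map (genericOrbitMap (paddedPerFormLex ℂ n m) m).toLinearMap).subtype ≤
      H ⊓ NP.map (genericOrbitMap (paddedPerFormLex ℂ n m) m).toLinearMap := by
    intro G hG
    obtain ⟨w, hw, rfl⟩ := Submodule.mem_map.mp hG
    obtain ⟨F', hF'N, hF'w⟩ := Submodule.mem_map.mp w.2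
    rw [AlgHom.toLinearMap_apply] at hF'w
    refine Submodule.mem_inf.mpr ⟨?_, w.2⟩
    rw [hH, Submodule.mem_iInf]
    refine fun g => (Submodule.mem_iInf _).mpr fun hg => ?_
    rw [LinearMap.mem_ker, LinearMap.sub_apply, sub_eq_zero]
    refine fourRow_borel_of_blockBorel p hp χ₄ ?_ (fun b hb => ?_) g hg
    · rw [Submodule.subtype_apply, ← hF'w]
      exact frb_genericOrbitMap_mem_supported p (paddedPerFormLex ℂ n m) (Submodule.mem_inf.mp hF'N).2
    · exact (hρP b w).symm.trans (congrArg Subtype.val ((mem_highestWeightSpace_iff _ _ _).mp hw b hb))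
  haveI : Module.Finite ℂ ↥(H ⊓ NP.map (genericOrbitMap (paddedPerFormLex ℂ n m) m).toLinearMap) :=
    Submodule.finiteDimensional_of_le inf_le_right
  have h1 : Module.finrank ℂ ↥(SD ⊓ H) ≤ hwMultiplicity ρD χ₄ := by
    rw [hwMultiplicity, ← Submodule.finrank_map_subtype_eq]
    exact Submodule.finrank_mono hleD
  have h2 : hwMultiplicity ρP χ₄ ≤
      Module.finrank ℂ ↥(H ⊓ NP.map (genericOrbitMap (paddedPerFormLex ℂ n m) m).toLinearMap) := by
    rw [hwMultiplicity, ← Submodule.finrank_map_subtype_eq]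
    exact Submodule.finrank_mono hleP
  exact lt_of_le_of_lt h1 (lt_of_lt_of_le hχ (h2.trans
    (fourRow_hwsp_inf_map_genericOrbitMap_le_orbitMultiplicity _ (NeZero.ne m) _ NP)))

/-- **stub_fourRowBridge** (line `four-row-count`, cruxes `ValuativeGCT.HeadFlip` / `ValuativeGCT.ValuativeFlip`;
four-row analogue of the landed B6 `stub_bottomBridge`, now `GL₄`-equivariant).  A dimension gap in
degree `δ` between the det-side four-row module `Hom_{mδ} ⊓ SAND ⊓ ROWS₄` (degree-`mδ` row-wise unimodular
sandwich invariants on `End(ℂ^{m×m})` that are functions of the last four row slots) and the per-side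
four-row image `Φ(Hom_δ ⊓ SUPP₄)` (`Φ = genericOrbitMap (X₀₀^{m-n} per_n) m` on the degree-`δ` forms in the
coefficients of the monomials in the four kept variables) yields a partition `λ ⊢ mδ` with `ℓ(λ) ≤ 4` and
`dim (Hom_{mδ} ⊓ SAND ⊓ HWSP(λ*)) < mult_{λ*} ℂ[Δ_m(X₀₀^{m-n} per_n)]`: `hfb_bridge` for the kept block of
the last four slots (an upper set of the lexicographic order; both modules are `GL₄`-stable,
`hfb_det_stable`, `hfb_per_stable`), `ℓ(λ) ≤ 4` because `λ*` vanishes off the kept slots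
(`frb_card_parts_le_of_toMatIdx_eq_zero`), and the det-side multiplicity space of a `≤ 4`-row weight
already lies in the four-row module (`fourRow_detMult_le_fourRow`).
[BLMW 2011 §5.2; Goodman–Wallach §3.2, §4.1; arXiv:1204.4693 Prop. 1.12; B6, B4] [folklore] -/
theorem stub_fourRowBridge :
    ∀ (n m : ℕ) [NeZero m] (δ : ℕ), n ≤ m → 2 ≤ m →
      Module.finrank ℂ ↥(MvPolynomial.homogeneousSubmodule (MatIdx m × MatIdx m) ℂ (m * δ) ⊓
        (⨅ (P : Matrix (Fin m) (Fin m) ℂ) (Q : Matrix (Fin m) (Fin m) ℂ) (_ : P.det = 1) (_ : Q.det = 1), LinearMap.ker ((MvPolynomial.aeval fun p : MatIdx m × MatIdx m => ∑ l : MatIdx m, (P (ofLex p.2).1 (ofLex l).1 * Q (ofLex l).2 (ofLex p.2).2) • (MvPolynomial.X (p.1, l) : MvPolynomial (MatIdx m × MatIdx m) ℂ)).toLinearMap - (LinearMap.id : MvPolynomial (MatIdx m × MatIdx m) ℂ →ₗ[ℂ] MvPolynomial (MatIdx m × MatIdx m) ℂ))) ⊓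
        Subalgebra.toSubmodule (MvPolynomial.supported ℂ {p : MatIdx m × MatIdx m | m * m ≤ (((matIdxEquiv m).symm p.1 : Fin (m * m)) : ℕ) + 4})) <
      Module.finrank ℂ ↥(((MvPolynomial.homogeneousSubmodule (DegIdx (MatIdx m) m) ℂ δ ⊓ Subalgebra.toSubmodule (MvPolynomial.supported ℂ {d : DegIdx (MatIdx m) m | ∀ i : MatIdx m, ¬ (m * m ≤ (((matIdxEquiv m).symm i : Fin (m * m)) : ℕ) + 4) → d.1 i = 0})).map (genericOrbitMap (paddedPerFormLex ℂ n m) m).toLinearMap)) →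
      ∃ lam : Nat.Partition (m * δ), lam.parts.card ≤ 4 ∧
        Module.finrank ℂ ↥(MvPolynomial.homogeneousSubmodule (MatIdx m × MatIdx m) ℂ (m * δ) ⊓
          (⨅ (P : Matrix (Fin m) (Fin m) ℂ) (Q : Matrix (Fin m) (Fin m) ℂ) (_ : P.det = 1) (_ : Q.det = 1), LinearMap.ker ((MvPolynomial.aeval fun p : MatIdx m × MatIdx m => ∑ l : MatIdx m, (P (ofLex p.2).1 (ofLex l).1 * Q (ofLex l).2 (ofLex p.2).2) • (MvPolynomial.X (p.1, l) : MvPolynomial (MatIdx m × MatIdx m) ℂ)).toLinearMap - (LinearMap.id : MvPolynomial (MatIdx m × MatIdx m) ℂ →ₗ[ℂ] MvPolynomial (MatIdx m × MatIdx m) ℂ))) ⊓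
          (⨅ (g : Matrix.GeneralLinearGroup (MatIdx m) ℂ) (_ : IsUpperTriangular g), LinearMap.ker ((MvPolynomial.aeval fun p : MatIdx m × MatIdx m => ∑ l : MatIdx m, ((g⁻¹ : Matrix.GeneralLinearGroup (MatIdx m) ℂ) : Matrix (MatIdx m) (MatIdx m) ℂ) p.1 l • (MvPolynomial.X (l, p.2) : MvPolynomial (MatIdx m × MatIdx m) ℂ)).toLinearMap - weightChar ((Weight.dualOfPartition (m * m) lam).toMatIdx : Weight (MatIdx m)) g • (LinearMap.id : MvPolynomial (MatIdx m × MatIdx m) ℂ →ₗ[ℂ] MvPolynomial (MatIdx m × MatIdx m) ℂ)))) <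
        orbitMultiplicity ℂ (paddedPerFormLex ℂ n m) m ((Weight.dualOfPartition (m * m) lam).toMatIdx : Weight (MatIdx m)) := by
  intro n m _ δ _ _ hgap
  haveI : Module.Finite ℂ ↥(MvPolynomial.homogeneousSubmodule (MatIdx m × MatIdx m) ℂ (m * δ)) :=
    Module.Finite.iff_fg.mpr (MvPolynomial.homogeneousSubmodule_fg _ _ _)
  obtain ⟨lam, hlamN, hzero, hlt⟩ := hfb_bridge
    (fun a : MatIdx m => m * m ≤ (((matIdxEquiv m).symm a : Fin (m * m)) : ℕ) + 4)
    (fun a b hab ha => le_trans ha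
      (Nat.add_le_add_right (Fin.val_fin_le.mpr ((matIdxEquiv m).symm.monotone hab)) 4))
    n δ (m * δ) _ (inf_le_left.trans inf_le_left)
    (fun g G hG => hfb_det_stable _ (m * δ) _ G hG) hgap
  have hlam4 : lam.parts.card ≤ 4 := frb_card_parts_le_of_toMatIdx_eq_zero lam hlamN hzero
  have hmono : ∀ {s t : Submodule ℂ (MvPolynomial (MatIdx m × MatIdx m) ℂ)},
      t ≤ MvPolynomial.homogeneousSubmodule (MatIdx m × MatIdx m) ℂ (m * δ) → s ≤ t →
      Module.finrank ℂ ↥s ≤ Module.finrank ℂ ↥t := fun {s t} htu hst => by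
    haveI : Module.Finite ℂ ↥t := Submodule.finiteDimensional_of_le htu
    exact Submodule.finrank_mono hst
  exact ⟨lam, hlam4, lt_of_le_of_lt (hmono (inf_le_left.trans (inf_le_left.trans inf_le_left))
    (le_inf (fourRow_detMult_le_fourRow m (m * δ) lam hlam4) inf_le_right)) hlt⟩

end

end Summit.ValiantsHypothesis.ValiantsHypothesis.Theorems.HeadFlip
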